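/-
Copyright: statement-level skeleton of a published paper (lit-balaban cell, Phase-2 proof seat p25, gen 22). No proof
claims beyond what the kernel checks below.
-/
import Literature.MathematicalPhysics.QuantumFieldTheory.BalabanImbrieJaffe1984to88.BIJ88RandomWalk242
import Literature.Probability.LatticeModels.PolymerGasGeometric

/-!
# `BalabanImbrieJaffe1984to88.BIJ88WalkSplit245Complete` — T. Bałaban, J. Imbrie, A. Jaffe, *Effective action and
cluster properties of the abelian Higgs model*, Commun. Math. Phys. **114** (1988) 257–315 [BalabanImbrieJaffe1988],
Sect. 2 p. 264 [PDF 8], verbatim: *"Let X be a connected union of r(e_k)-cubes, and let X⁰ be the cubes of X not at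
the boundary of X. We define C^{(k)}_{Λ,X}(u; x₁, x₂) = Σ^X_ω C_ω(x₁, x₂), (2.44) … Then we define C^{(k)}_Λ(u) =
C^{(k)}_{Λ,loc}(u) + Σ_X C^{(k)}_{Λ,X}(u), (2.45)"* — **PRINT'S SUM OVER CONNECTED `X` IS THE WHOLE EXPANSION** (p25
gen 22; file W6d, a MEMBER of row C2.Claim@312, owner r16, referee ref-5 — it certifies that the covariance family
fed to the head in `BIJ88WalkIneq312Split245` (`none ↦ C_loc`, `some X ↦ C_X` over the subtype of connected `X`) is
COMPLETE; reader edges to rows C2.Eq2.42/2.44/2.45, owner r18; nothing of record changed).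

p13's `BIJ88RandomWalk242` PROVES (2.45) with the index type ALL `X : Finset κ` (`eq245_of_eq242`) and, separately,
that `C^{(k)}_{Λ,X} ≠ 0` forces the cube graph induced on `X` to be connected (`cX_ne_zero_connected`, §8).  The §5.14
files index the region pieces by the subtype `{X // IsRConnected R_K X}` of the tree's lattice-animal vocabulary
(`Literature.Probability.LatticeModels.IsRConnected`, used by the per-cube animal sums of W4b).  Here the two notions
are bridged (`isRConnected_of_induce_connected`, for the symmetrized cube adjacency) and (2.45) is re-assembled over
the connected subtype (`eq245_connected`): `C = C_loc + Σ_{X connected} C_X` — print's display with print's index set.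

statement-level skeleton of published theorems with citation tags; proofs where landed; nothing here is a claim
about the Yang–Mills mass gap

PDF held: `paper:balaban1988-cmp114-bij-abelian-higgs-effective-action` (journal page = PDF page + 256); p. 264 = PDF 8.

CITATION HEADER (lean-in-tree rule).  lit-balaban cell (HOME `run/shared/lean/pub/lit-balaban/`), Phase 2, seat p25
gen 22; row **C2.Claim@312** of `HOME/lit-balaban-r16/ROWS-C2-part2.md` (owner r16, referee ref-5; MEMBER), reader of
rows C2.Eq2.42/2.44/2.45 (`HOME/lit-balaban-r18/ROWS-C2.md`).  USED BY NAME, nothing restated: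
`BIJ88RandomWalk242.{Eq242, cLoc, cX, eq245_of_eq242, cX_ne_zero_connected}` (p13), `BIJ88Sect2Statements.Eq245` (r18),
`Literature.Probability.LatticeModels.IsRConnected`.

## What is proved (0 `sorry`, standard axioms, no new `Prop` facts; theorems only, no definitions)

* `isRConnected_of_induce_connected` (bridge: induced cube graph connected ⇒ `IsRConnected` for the symmetrized
  adjacency), `cX_eq_zero_of_not_isRConnected`, **`eq245_connected`** ((2.45) over the connected subtype).
HONEST SCOPE: p13's hypotheses verbatim — walk terms living on nearest-neighbour walks (`hNN`, [6] (2.13)) whose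
consecutive labels have equal or adjacent cubes (`hstep`, `M ≤ r(e_k)`); abstract kernels; no bound.  NOT summit
progress; NOT continuum; NOT Clay.  Imports `BIJ88RandomWalk242`, `LatticeModels.PolymerGasGeometric`; modifies nothing.
-/

namespace Literature.MathematicalPhysics.QuantumFieldTheory.BalabanImbrieJaffe1984to88.BIJ88WalkSplit245Complete

open Classical Finset
open BIJ88RandomWalk242
open Literature.Probability.LatticeModels (IsRConnected)

variable {ι α κ : Type} [DecidableEq ι] [Fintype κ] [DecidableEq κ]

omit [DecidableEq ι] [Fintype κ] [DecidableEq κ] in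
/-- **BRIDGE**: if the cube graph (adjacency `cadj` symmetrized, `SimpleGraph.fromRel`) induced on `X` is connected,
then `X` is `IsRConnected` for the symmetrized adjacency — p13's connectedness notion implies the lattice-animal one
of `LatticeModels`. [cite: BalabanImbrieJaffe1988, (2.44) p.264] -/
theorem isRConnected_of_induce_connected (cadj : κ → κ → Prop) {X : Finset κ}
    (h : ((SimpleGraph.fromRel cadj).induce (↑X : Set κ)).Connected) :
    IsRConnected (fun a b => cadj a b ∨ cadj b a) X := by
  have hne : X.Nonempty := by
    obtain ⟨⟨v, hv⟩⟩ := h.nonempty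
    exact ⟨v, hv⟩
  refine ⟨hne, fun v hv w hw => ?_⟩
  have hr := h.preconnected ⟨v, hv⟩ ⟨w, hw⟩
  rw [SimpleGraph.reachable_iff_reflTransGen] at hr
  -- transport the chain of adjacent cubes along `Subtype.val`
  have key : ∀ b : ↥(↑X : Set κ), Relation.ReflTransGen ((SimpleGraph.fromRel cadj).induce (↑X : Set κ)).Adj ⟨v, hv⟩ b →
      Relation.ReflTransGen (fun x y => (cadj x y ∨ cadj y x) ∧ x ∈ X ∧ y ∈ X) v b.1 := by
    intro b hb
    induction hb with
    | refl => exact Relation.ReflTransGen.refl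
    | @tail b' c' _ hbc ih =>
        rw [SimpleGraph.induce_adj, SimpleGraph.fromRel_adj] at hbc
        exact ih.tail ⟨hbc.2, b'.2, c'.2⟩
  exact key ⟨w, hw⟩ hr

omit [Fintype κ] in
/-- **ONLY CONNECTED `X` CARRY `C^{(k)}_{Λ,X}`** (p13's `cX_ne_zero_connected` through the bridge): if the walk terms live
on nearest-neighbour walks (`hNN`) whose consecutive labels have equal or adjacent cubes (`hstep`), then
`C^{(k)}_{Λ,X} = 0` for every `X` that is not `IsRConnected`. [cite: BalabanImbrieJaffe1988, (2.44) p.264] -/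
theorem cX_eq_zero_of_not_isRConnected [Fintype κ] (ldist : ι → α → ℝ) (ρ : ℝ) (cubeOf : ι → κ)
    (cadj : κ → κ → Prop) {Cw : Walk ι → α → α → ℝ} (adj : ι → ι → Prop)
    (hstep : ∀ j j', adj j j' → cubeOf j = cubeOf j' ∨ cadj (cubeOf j) (cubeOf j') ∨ cadj (cubeOf j') (cubeOf j))
    (hNN : ∀ ω x₁ x₂, Cw ω x₁ x₂ ≠ 0 → ω.IsNN adj) {X : Finset κ}
    (hX : ¬ IsRConnected (fun a b => cadj a b ∨ cadj b a) X) (x₁ x₂ : α) :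
    cX ldist ρ cubeOf cadj Cw X x₁ x₂ = 0 := by
  by_contra h
  exact hX (isRConnected_of_induce_connected cadj (cX_ne_zero_connected ldist ρ cubeOf cadj adj hstep hNN h))

/-- **(2.45) OVER PRINT'S INDEX SET** (*"Let X be a connected union of r(e_k)-cubes"*): for a kernel `C` with the
convergent walk expansion (2.42), `C(x₁,x₂) = C_loc(x₁,x₂) + Σ_{X connected} C_X(x₁,x₂)`, the sum over the subtype of
`IsRConnected` regions (symmetrized cube adjacency) — the typed row `BIJ88Sect2Statements.Eq245` with index type that
subtype; i.e. the covariance family `none ↦ C_loc`, `some X ↦ C_X` of `BIJ88WalkIneq312Split245` is COMPLETE.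
[cite: BalabanImbrieJaffe1988, (2.45) p.264] -/
theorem eq245_connected (ldist : ι → α → ℝ) (ρ : ℝ) (cubeOf : ι → κ) (cadj : κ → κ → Prop)
    {C : α → α → ℝ} {Cw : Walk ι → α → α → ℝ} (h242 : Eq242 C Cw) (adj : ι → ι → Prop)
    (hstep : ∀ j j', adj j j' → cubeOf j = cubeOf j' ∨ cadj (cubeOf j) (cubeOf j') ∨ cadj (cubeOf j') (cubeOf j))
    (hNN : ∀ ω x₁ x₂, Cw ω x₁ x₂ ≠ 0 → ω.IsNN adj) :
    BIJ88Sect2Statements.Eq245 C (cLoc ldist ρ Cw)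
      (fun r : {X : Finset κ // IsRConnected (fun a b => cadj a b ∨ cadj b a) X} => cX ldist ρ cubeOf cadj Cw r.1) := by
  intro x₁ x₂
  have hz : ∀ X ∈ (univ : Finset (Finset κ)), cX ldist ρ cubeOf cadj Cw X x₁ x₂ ≠ 0 →
      IsRConnected (fun a b => cadj a b ∨ cadj b a) X := fun X _ hX => by
    by_contra hc
    exact hX (cX_eq_zero_of_not_isRConnected ldist ρ cubeOf cadj adj hstep hNN hc x₁ x₂)
  rw [eq245_of_eq242 ldist ρ cubeOf cadj h242 x₁ x₂, ← Finset.sum_filter_of_ne hz,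
    Finset.sum_subtype (F := inferInstance) (p := fun X : Finset κ => IsRConnected (fun a b => cadj a b ∨ cadj b a) X)
      (univ.filter fun X : Finset κ => IsRConnected (fun a b => cadj a b ∨ cadj b a) X)
      (fun X => by simp only [Finset.mem_filter, Finset.mem_univ, true_and])]

end Literature.MathematicalPhysics.QuantumFieldTheory.BalabanImbrieJaffe1984to88.BIJ88WalkSplit245Complete
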